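import Mathlib
import Literature.MathematicalPhysics.StatisticalMechanics.BarlowStackingEnergy
import Literature.MathematicalPhysics.StatisticalMechanics.Crystallization

/-!
# Sketch — crux `LayeredLawsSelectHcp` (stmt-AtomisticToContinuum-9226), crux-ideate round 1, ideator 1

First lemmas of the two idea cards, typed over existing declarations (nothing here is proved; these
are the first checkable statements of each line, `def … : Prop`).

* Card `mtp-prestress-split-ergodic-frame` (rigidity half):
  `PrestressSplitWithWork` (finite algebraic identity: the prestress split with the first-order WORK
  term kept explicit — no force-balance hypothesis; provable now), `HcpZeroStress` (the squared-length
  site stress of hcp vanishes at an interior minimiser of the hcp energy over `(a, h)`; zero stress is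
  what kills the expected work term at the measure level).
* Card `stress-jump-young-hagg-density` (selection half):
  `IdealStackingForcesVertical`, `HcpSiteForceZero` (site symmetry `C₃ᵥ` / `D₃ₕ`),
  `layerForceCoupling`, `CutForceCouplingBound` (the certified-numerics input, in the box of item 3063).
-/

noncomputable section

open scoped BigOperators
open Finset

namespace Summit.AtomisticToContinuum.Crystallization.Cruxes.LayeredLawsSelectHcp.IdeatorOne

open Literature.MathematicalPhysics.StatisticalMechanics

abbrev E3 := EuclideanSpace ℝ (Fin 3)

/-! ## Card 1 — measure-level prestress split -/

/-- Pair energy written through SQUARED lengths: `sqEnergy W x = ∑_{i<j} W ‖x j − x i‖²`. -/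
def sqEnergy {N : ℕ} (W : ℝ → ℝ) (x : Fin N → E3) : ℝ :=
  ∑ i, ∑ j ∈ Finset.Ioi i, W (‖x j - x i‖ ^ 2)

/-- The Lennard-Jones well in squared length: `W(s) = s⁻⁶/12 − s⁻³/6`, so `V_LJ(r) = W(r²)`. -/
def ljW (s : ℝ) : ℝ := (1 / 12) * (s⁻¹) ^ 6 - (1 / 6) * (s⁻¹) ^ 3

/-- `W'(s) = ½ (s⁻⁴ − s⁻⁷)` (negative for `s < 1`: compressed first-shell STRUTS; positive beyond:
CABLES). -/
def ljW' (s : ℝ) : ℝ := (1 / 2) * ((s⁻¹) ^ 4 - (s⁻¹) ^ 7)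

/-- **Prestress split with explicit work term** (finite shadow of the measure-level identity).
For ANY reference `y` (not assumed force-balanced), any symmetric bond weights `ω` (to be
`ω i j = W'(‖y j − y i‖²)`) and any deformed `x`, writing `δ_ij = (x j − x i) − (y j − y i)`:
`E(x) − E(y) = Σ_{i<j} [W̃_ij(s_ij) − W̃_ij(s*_ij)] + Σ_{i<j} ω_ij ‖δ_ij‖² + 2 Σ_{i<j} ω_ij ⟪y j − y i, δ_ij⟫`,
`W̃_ij(s) = W(s) − ω_ij s`. Pure algebra (`‖r + δ‖² = ‖r‖² + 2⟪r, δ⟫ + ‖δ‖²`); provable now.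
At the measure level the LAST (work) term has expectation `2 S : (G − R₀)` with `S = Σ_q ω_q q ⊗ q`
the reference site stress and `G` the mean labelled bond-vector gradient (MTP additivity) — hence
`0` by `HcpZeroStress`, for every global orientation `R₀`. -/
def PrestressSplitWithWork : Prop :=
  ∀ (N : ℕ) (W : ℝ → ℝ) (ω : Fin N → Fin N → ℝ) (x y : Fin N → E3),
    (∀ i j, ω i j = ω j i) →
    sqEnergy W x - sqEnergy W y =
      (∑ i, ∑ j ∈ Finset.Ioi i,
        ((W (‖x j - x i‖ ^ 2) - ω i j * ‖x j - x i‖ ^ 2) -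
          (W (‖y j - y i‖ ^ 2) - ω i j * ‖y j - y i‖ ^ 2))) +
      (∑ i, ∑ j ∈ Finset.Ioi i, ω i j * ‖(x j - x i) - (y j - y i)‖ ^ 2) +
      2 * ∑ i, ∑ j ∈ Finset.Ioi i, ω i j * inner ℝ (y j - y i) ((x j - x i) - (y j - y i))

/-- Energy of the site `0` of the relaxed hcp stacking `hcpStacking a h` (`0 = barlowPos a h _ 0 0 0`
is a site): `½ Σ_{y ≠ 0} V_LJ ‖y‖` (a `tsum`; absolutely convergent for `0 < a, h`). By
vertex-transitivity of hcp this is the energy per particle `e(hcp a h)`. -/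
def hcpSiteEnergy (a h : ℝ) : ℝ :=
  (1 / 2) * ∑' y : {y : E3 // y ∈ hcpStacking a h ∧ y ≠ 0}, lennardJones ‖y.1‖

/-- The squared-length **site stress** of hcp at the origin: `S_ij = Σ_{y ≠ 0} W'(‖y‖²) yᵢ yⱼ`
(`= ½ Σ V'(‖y‖) yᵢyⱼ/‖y‖`, the static virial stress per site; trace = virial). -/
def hcpSiteStress (a h : ℝ) (i j : Fin 3) : ℝ :=
  ∑' y : {y : E3 // y ∈ hcpStacking a h ∧ y ≠ 0}, ljW' (‖y.1‖ ^ 2) * (y.1 i * y.1 j)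

/-- **Zero stress of relaxed hcp** (first lemma of card 1, deterministic input): if `(a*, h*)` is an
interior minimiser of the hcp energy per site over the open quadrant, the full `3 × 3` site stress
vanishes (diagonal entries by criticality in `a` and `h` + hexagonal symmetry, off-diagonal by the
mirror symmetries of the `D₃ₕ` site; the trace is the zero-pressure virial identity). -/
def HcpZeroStress : Prop :=
  ∀ a h : ℝ, 0 < a → 0 < h →
    IsMinOn (fun p : ℝ × ℝ => hcpSiteEnergy p.1 p.2) (Set.Ioi (0 : ℝ) ×ˢ Set.Ioi (0 : ℝ)) (a, h) →
    ∀ i j : Fin 3, hcpSiteStress a h i j = 0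

/-! ## Card 2 — stress jump of the ideal own-word stacking -/

/-- `V_LJ'(r) = −r⁻¹³ + r⁻⁷`. -/
def ljDeriv (r : ℝ) : ℝ := -(r⁻¹) ^ 13 + (r⁻¹) ^ 7

/-- The **force on the site** `x = barlowPos a h s m 0 0` of the ideal Barlow stacking of word `s`
(uniform spacings `a`, `h`): `F = Σ_{y ≠ x} V'(‖y − x‖) (y − x)/‖y − x‖` (minus the gradient of the
site's interaction energy; a `tsum` in `E3`). The same for every site of layer `m` (in-layer
translations). -/
def siteForce (a h : ℝ) (s : ℤ → ℤ) (m : ℤ) : E3 :=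
  ∑' y : {y : E3 // y ∈ barlowStacking a h s ∧ y ≠ barlowPos a h s m 0 0},
    (ljDeriv (dist (barlowPos a h s m 0 0) y.1) / dist (barlowPos a h s m 0 0) y.1) •
      (y.1 - barlowPos a h s m 0 0)

/-- **Ideal stackings carry only vertical, layer-uniform forces** (first lemma of card 2): for every
Hägg word and all spacings, the lateral components of the site force vanish — the three-fold axis
through every site maps each coset `A`, `B = w + L`, `C = 2w + L` of the triangular lattice `L` to
itself. Hence a fault exerts on the surrounding layers only vertical, layer-uniform,
self-equilibrated forces. -/
def IdealStackingForcesVertical : Prop :=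
  ∀ (a h : ℝ) (s : ℤ → ℤ), 0 < a → 0 < h → IsHaggSeq s → ∀ m : ℤ,
    siteForce a h s m 0 = 0 ∧ siteForce a h s m 1 = 0

/-- For the hcp word the vertical component vanishes too (horizontal mirror of the `D₃ₕ` site:
layers `m + k` and `m − k` carry the same letter relative to `m`), for ALL `a, h` — hcp at hcp's
relaxed parameters is force-free, whereas a faulted word at the same parameters is not
(`siteForce … 2 = Σ_{k ≥ 2} g_k · (𝟙[aligned(m, m+k)] − 𝟙[aligned(m−k, m)])`). -/
def HcpSiteForceZero : Prop :=
  ∀ a h : ℝ, 0 < a → 0 < h → ∀ m : ℤ, siteForce a h alternatingHagg m = 0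

/-- The **layer force coupling** `g_k(a, h)`: aligned-minus-non-aligned vertical force exerted on a
site by a full layer at distance `k`, `g_k = (1/k) ∂J_k/∂h` with `J_k = barlowCoupling lennardJones`
(tree). Poisson–Bessel asymptotics: `g_k ≈ −2π|ξ₁| J_k ≈ −(7.3/a) J_k`. -/
def layerForceCoupling (a h : ℝ) (k : ℕ) : ℝ :=
  deriv (fun t : ℝ => barlowCoupling lennardJones a t k) h / k

/-- **Cut-force coupling bound** (certified-numerics input of card 2, same box and engine as item
3063 `LjRegistryDomination`): on the relaxation box the force couplings are summable against `k` and
`Σ_{k ≥ 2} k |g_k| ≤ 24 |J₂|`. Consequence: the stress jump across any cut of a faulted ideal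
stacking is `≤ 24 |J₂| ≈ 1.8e-3`, so elastic relaxation can lower a fault's cost by at most
`(24 J₂)²/(2 c_gap)` per fault column, against the Hägg gain `≥ |J₂|/2` (0737 with 3063). -/
def CutForceCouplingBound : Prop :=
  ∀ a h : ℝ, 47 / 50 ≤ a → a ≤ 1 → 39 / 50 * a ≤ h → h ≤ 17 / 20 * a →
    Summable (fun k : ℕ => (k : ℝ) * |layerForceCoupling a h k|) ∧
    ∑' k : ℕ, (if 2 ≤ k then (k : ℝ) * |layerForceCoupling a h k| else 0) ≤
      24 * |barlowCoupling lennardJones a h 2|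

/-- Sanity: the tree's `lennardJones` is `ljW` of the squared distance (so card 1's squared-length
bookkeeping is about the crux's potential). Provable now (`(r⁻¹)^12 = ((r^2)⁻¹)^6`). -/
def LennardJonesIsSq : Prop := ∀ r : ℝ, 0 < r → lennardJones r = ljW (r ^ 2)

end Summit.AtomisticToContinuum.Crystallization.Cruxes.LayeredLawsSelectHcp.IdeatorOne
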